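import Summits.QuantumFields.YangMills.Theorems.LuscherReductionTwistedTraceScalingBOCentralTube
import Summits.QuantumFields.YangMills.Theorems.LuscherReductionTwistedTraceScalingBOStiffRing
import Summits.QuantumFields.YangMills.Theorems.TwistedTraceScaling.Negative.OutPieceMagneticBound
import HarnessLib

/-!
# (B-ST) (W1-10 (A1)) `…BOStiffActionHessian`: on the profile ball, `(β/2)·S(orthoTube 1 y) = ⟨ŷ, (β/2)H ŷ⟩ + o(1)` with an ABSOLUTE error — the harmonic replacement for (A)
# (lane A of S-BASE, crux `TwistedTraceScaling` stmt-QuantumFields-20203, C4-CORE, the (B-ST) pen; lead g22 22:27Z split (A1); cdisprove R67/R68: absolute-o(1) form only)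

For `y ∈ cS β` (`ŷ = linkEmbed y`, `‖ŷ‖ ≤ r_f = β^{-1/2}ℓ`): ★★ `abs_action_sub_hessian_le` (β-pointwise, radii explicit) and ★★★ `eventually_action_hessian_cS` —
`∀ ε > 0, ∀ᶠ β, ∀ y ∈ cS β, |(β/2)·S(oT 1 y) − ⟨ŷ, ((β/2)•H) ŷ⟩| ≤ ε` (`H = stiffHessian L = curl†curl`).  Chain: ✓`tube_centre_chart_data` (oT 1 y = P(w'), `Σ w'_e² ≤ (2T)²`,
`‖chartVec w' − ŷ‖ ≤ 6T²R`, `‖chartVec w'‖ ≤ 2R`), ✓`abs_wilsonAction_gnomonic_sub_curl_le` (`|S(P w') − ‖curl(chartVec w')‖²| ≤ 2000|P|(2T)³`), ✓`norm_latCurl_sq_le` (`‖curl v‖² ≤ 96‖v‖²`),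
✓`inner_stiffHessian`; with `T = R = β^{-1/2}ℓ` the error is `β·O(β^{-3/2}ℓ³ + β^{-2}ℓ⁴) → 0` — absolute, as R67/R68 require (never a relative `(1±θ)β(…)`).
HONEST FRAMING: elementary estimate for a stub of a child of the CONDITIONAL route R2b1; (Q±) OPEN; (B-ST), C4-CORE OPEN; not infinite volume, not a gap, not Clay.
-/

set_option autoImplicit false

noncomputable section

open MeasureTheory Filter Topology Real
open scoped BigOperators RealInnerProductSpace
open Literature.MathematicalPhysics.QuantumFieldTheory
open Literature.MathematicalPhysics.QuantumLattice

namespace Summit.QuantumFields.YangMills.Theorems.FemtoTransferGap.TwoLattice.ConstTube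

open Summit.QuantumFields.YangMills.Theorems.FemtoTransferGap
open Summit.QuantumFields.YangMills.Theorems.FemtoTransferGap.TwoLattice
open Summit.QuantumFields.YangMills.Theorems.FemtoTransferGap.TwoLattice.Avg
open Summit.QuantumFields.YangMills.Theorems.FemtoTransferGap.TwoLattice.Stiff
open Summit.QuantumFields.YangMills.Theorems.FemtoTransferGap.TwoLattice.GnChart
open Summit.QuantumFields.YangMills.Theorems.TwistedTraceScaling.Negative

variable {L : ℕ} [NeZero L]

/-! ## §1 The pointwise estimate -/

omit [NeZero L] in
/-- `|‖a‖² − ‖b‖²| ≤ ‖a − b‖·(‖a‖ + ‖b‖)` in a normed group. [folklore] -/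
theorem abs_norm_sq_sub_norm_sq_le {E : Type*} [SeminormedAddCommGroup E] (a b : E) : |‖a‖ ^ 2 - ‖b‖ ^ 2| ≤ ‖a - b‖ * (‖a‖ + ‖b‖) := by
  have h1 : |‖a‖ - ‖b‖| ≤ ‖a - b‖ := abs_norm_sub_norm_le a b
  have e : ‖a‖ ^ 2 - ‖b‖ ^ 2 = (‖a‖ - ‖b‖) * (‖a‖ + ‖b‖) := by ring
  rw [e, abs_mul, abs_of_nonneg (by positivity : 0 ≤ ‖a‖ + ‖b‖)]
  exact mul_le_mul_of_nonneg_right h1 (by positivity)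

/-- ★★ **ACTION vs HESSIAN at a central tube point, pointwise**: for `β ≥ 0`, a cap point `y` with entries `|y_{e,c}| ≤ T ≤ 1/16` and `‖ŷ‖ ≤ R`:
`|(β/2)·S(oT 1 y) − ⟨ŷ, ((β/2)•H)ŷ⟩| ≤ (β/2)·(16000|P|T³ + 96·6T²R·(2R + R))`. [cite: Luscher1983, §3] -/
theorem abs_action_sub_hessian_le {β : ℝ} (hβ : 0 ≤ β) {T R : ℝ} (hT0 : 0 ≤ T) (hT : T ≤ 1 / 16) {y : Edge 3 L → Fin 3 → ℝ}
    (hyT : ∀ (e : Edge 3 L) (c : Fin 3), |y e c| ≤ T) (hyR : ‖linkEmbed L y‖ ≤ R) :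
    |β / 2 * wilsonAction su2Rep (orthoTube L 1 y) - ⟪linkEmbed L y, ((β / 2) • stiffHessian L) (linkEmbed L y)⟫| ≤
      β / 2 * (2000 * Fintype.card (Plaquette 3 L) * (2 * T) ^ 3 + Real.sqrt 96 * (6 * T ^ 2 * R) * (Real.sqrt 96 * (2 * R) + Real.sqrt 96 * R)) := by
  obtain ⟨hrep, hw, hdiff, hcv, -⟩ := tube_centre_chart_data (L := L) (t := 0) le_rfl (b := 0) le_rfl (ρ := 8 * T) hT0 le_rfl (by linarith) hyT hyR
  set w' : Edge 3 L → Fin 3 → ℝ := fun e => gnLink (chartSU2 (y e)) with hw'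
  have hR0 : 0 ≤ R := (norm_nonneg _).trans hyR
  -- (1) the action is the curl form of the chart vector up to `2000|P|(2T)³`
  have h1 := abs_wilsonAction_gnomonic_sub_curl_le (L := L) (ρ := 2 * T) (by positivity) (by linarith) w' hw
  -- (2) the curl forms of `chartVec w'` and `ŷ` differ by `≤ √96·6T²R·√96(2R + R)`
  have hc : ∀ v : LinkSpace L, ‖latCurl L v‖ ≤ Real.sqrt 96 * ‖v‖ := fun v => by
    have h := norm_latCurl_sq_le (L := L) v
    have h' : ‖latCurl L v‖ ^ 2 ≤ (Real.sqrt 96 * ‖v‖) ^ 2 := by rw [mul_pow, Real.sq_sqrt (by norm_num)]; exact h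
    exact (pow_le_pow_iff_left₀ (norm_nonneg _) (by positivity) two_ne_zero).mp h'
  have h2 : |‖latCurl L (chartVec w')‖ ^ 2 - ‖latCurl L (linkEmbed L y)‖ ^ 2| ≤ Real.sqrt 96 * (6 * T ^ 2 * R) * (Real.sqrt 96 * (2 * R) + Real.sqrt 96 * R) := by
    refine (abs_norm_sq_sub_norm_sq_le _ _).trans ?_
    have ha : ‖latCurl L (chartVec w') - latCurl L (linkEmbed L y)‖ ≤ Real.sqrt 96 * (6 * T ^ 2 * R) := by
      rw [← map_sub]; exact (hc _).trans (mul_le_mul_of_nonneg_left hdiff (Real.sqrt_nonneg _))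
    have hb : ‖latCurl L (chartVec w')‖ + ‖latCurl L (linkEmbed L y)‖ ≤ Real.sqrt 96 * (2 * R) + Real.sqrt 96 * R :=
      add_le_add ((hc _).trans (mul_le_mul_of_nonneg_left hcv (Real.sqrt_nonneg _))) ((hc _).trans (mul_le_mul_of_nonneg_left hyR (Real.sqrt_nonneg _)))
    exact mul_le_mul ha hb (by positivity) (by positivity)
  -- assemble
  rw [← hrep] at h1
  have e : ⟪linkEmbed L y, ((β / 2) • stiffHessian L) (linkEmbed L y)⟫ = β / 2 * ‖latCurl L (linkEmbed L y)‖ ^ 2 := by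
    rw [LinearMap.smul_apply, inner_smul_right, inner_stiffHessian]
  rw [e, ← mul_sub, abs_mul, abs_of_nonneg (by positivity : (0:ℝ) ≤ β / 2)]
  refine mul_le_mul_of_nonneg_left ?_ (by positivity)
  calc |wilsonAction su2Rep (orthoTube L 1 y) - ‖latCurl L (linkEmbed L y)‖ ^ 2|
      ≤ |wilsonAction su2Rep (orthoTube L 1 y) - ‖latCurl L (chartVec w')‖ ^ 2| + |‖latCurl L (chartVec w')‖ ^ 2 - ‖latCurl L (linkEmbed L y)‖ ^ 2| := abs_sub_le _ _ _
    _ ≤ _ := add_le_add h1 h2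

/-! ## §2 ★★★ Eventually on `cS β` -/

/-- ★★★ **HARMONIC REPLACEMENT ON THE PROFILE BALL, absolute error → 0**: `∀ ε > 0, ∀ᶠ β, ∀ y ∈ cS β, |(β/2)·S(oT 1 y) − ⟨ŷ,((β/2)•H)ŷ⟩| ≤ ε`. [cite: Luscher1983, §3] -/
theorem eventually_action_hessian_cS {ε : ℝ} (hε : 0 < ε) :
    ∀ᶠ β : ℝ in atTop, ∀ y ∈ cS L β, |β / 2 * wilsonAction su2Rep (orthoTube L 1 y) - ⟪linkEmbed L y, ((β / 2) • stiffHessian L) (linkEmbed L y)⟫| ≤ ε := by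
  -- the radius `r = powScale (1/2) β * btLog β ≥ r_f` and the error function
  set P : ℝ := (Fintype.card (Plaquette 3 L) : ℝ) with hP
  have trf : Tendsto (fun β : ℝ => powScale (1 / 2) β * btLog β) atTop (𝓝 0) := by
    simpa only [pow_one] using tendsto_powScale_mul_btLog_pow (p := 1 / 2) (by norm_num) 1
  have t3 : Tendsto (fun β : ℝ => powScale (1 / 2) β * btLog β ^ 3) atTop (𝓝 0) := tendsto_powScale_mul_btLog_pow (p := 1 / 2) (by norm_num) 3
  have t4 : Tendsto (fun β : ℝ => powScale 1 β * btLog β ^ 4) atTop (𝓝 0) := tendsto_powScale_mul_btLog_pow (p := 1) (by norm_num) 4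
  -- the error `β/2·(16000 P r³ + 96·18 r⁴) = 8000P·(βr³) + 864·(βr⁴)` with `βr³ = p½ℓ³`, `βr⁴ = p1 ℓ⁴`
  have terr : Tendsto (fun β : ℝ => 8000 * P * (powScale (1 / 2) β * btLog β ^ 3) + 864 * (powScale 1 β * btLog β ^ 4)) atTop (𝓝 0) := by
    have h := (t3.const_mul (8000 * P)).add (t4.const_mul 864); simpa using h
  filter_upwards [eventually_ge_atTop (1 : ℝ), trf.eventually (eventually_le_nhds (by norm_num : (0:ℝ) < 1 / 16)),
    terr.eventually (eventually_le_nhds hε)] with β hβ1 hr16 herr y hy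
  obtain ⟨hycap, hyr⟩ := mem_cS hy
  set r : ℝ := powScale (1 / 2) β * btLog β with hrdef
  have hr0 : 0 ≤ r := mul_nonneg (powScale_pos _ _).le (zero_le_one.trans (one_le_btLog β))
  have hyR : ‖linkEmbed L y‖ ≤ r := hyr.trans (min_le_right _ _)
  have hyT : ∀ (e : Edge 3 L) (c : Fin 3), |y e c| ≤ r := fun e c => (R59.abs_entry_le_norm_linkEmbed y e c).trans hyR
  have h := abs_action_sub_hessian_le (L := L) (by linarith : (0:ℝ) ≤ β) hr0 hr16 hyT hyR
  refine h.trans ?_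
  -- `β/2·(2000P(2r)³ + √96·6r²r·(√96·2r + √96 r)) = 8000P·βr³ + 864·βr⁴`
  have hs : Real.sqrt 96 * Real.sqrt 96 = 96 := Real.mul_self_sqrt (by norm_num)
  have e1 : β / 2 * (2000 * P * (2 * r) ^ 3 + Real.sqrt 96 * (6 * r ^ 2 * r) * (Real.sqrt 96 * (2 * r) + Real.sqrt 96 * r)) =
      8000 * P * (β * r ^ 3) + 864 * (β * r ^ 4) := by
    have e0 : Real.sqrt 96 * (6 * r ^ 2 * r) * (Real.sqrt 96 * (2 * r) + Real.sqrt 96 * r) = (Real.sqrt 96 * Real.sqrt 96) * (18 * r ^ 4) := by ring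
    rw [e0, hs]; ring
  have hβp : β * powScale (1 / 2) β ^ 2 = 1 := mul_powScale_half_sq hβ1
  have hp1 : powScale 1 β = powScale (1 / 2) β ^ 2 := by rw [sq, powScale_mul_powScale]; norm_num
  have e2 : β * r ^ 3 = powScale (1 / 2) β * btLog β ^ 3 := by
    rw [hrdef]; calc β * (powScale (1 / 2) β * btLog β) ^ 3 = (β * powScale (1 / 2) β ^ 2) * (powScale (1 / 2) β * btLog β ^ 3) := by ring
      _ = _ := by rw [hβp, one_mul]
  have e3 : β * r ^ 4 = powScale 1 β * btLog β ^ 4 := by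
    rw [hrdef, hp1]; calc β * (powScale (1 / 2) β * btLog β) ^ 4 = (β * powScale (1 / 2) β ^ 2) * (powScale (1 / 2) β ^ 2 * btLog β ^ 4) := by ring
      _ = _ := by rw [hβp, one_mul]
  rw [hP] at e1 herr
  rw [e1, e2, e3]
  exact herr

end Summit.QuantumFields.YangMills.Theorems.FemtoTransferGap.TwoLattice.ConstTube

end
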